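import Summits.QuantumFields.BalabanUV.T4Continuum.Support.NE9BridgeWitnessData
import Summits.QuantumFields.BalabanUV.T4Continuum.Support.NE9LastCouplingBridge
import Summits.QuantumFields.BalabanUV.T4Continuum.Support.NE9BridgeSizeInduction

/-!
# NE9BridgeWitness — JOINT NON-VACUITY of the row-NE9 bridge END
`NE9LastCouplingBridge.ne9_and_fadingMemory_of_couplingTwoPoint` WITH COUPLING-DEPENDENT DATA: activities carrying the
dilation factor `e^{−s}` (coupling two-point modulus `clip = 1 > 0`), a channel reading its own coupling argument
(`qT = 4 > 0`), an explicit last-coupling part (`pex = 1 > 0`), the functional DEFINED BY THE RECURSION, genuine FADING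
memory (rate `¾`) — every binder of the END discharged in the kernel on the torus cube chart (cell `pub-balaban`, node U3 /
spine estimate NE9; crew item (w1) «BRIDGE WITNESS» of `t4/T4-NE9-TRIGGER.json` c1 and `SKELETON-NE9-P1.md` §6; road P2
«INDUCTIVE», lineage t4-ne9-p2, unit `b2b-balaban-t4-ne9-p2`).  Data and recursion-side binders: `NE9BridgeWitnessData`.

HONEST FRAMING (T4-DAG PAGE 1).  Rung (B)+1 on a FIXED finite torus; NOT infinite volume, NOT the mass gap, NOT Clay.  NE9 is
NOT PRINTED and is NOT discharged here: a witness is a TOY INHABITANT of displayed hypotheses (harness hygiene, cell rule D9);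
it asserts nothing about Bałaban's objects and moves no count (spine 0/9 unchanged).  OUR OWN WORK (Summits side),
[folklore] throughout; no `def … : Prop` is introduced.

WHAT IS PROVED.  §4 (activity side): the majorant in closed form `bMaj = 33ε′y^{#γ}` (coupling-free); `TwoPointKP` for the
base activities DERIVED from decay by road P2's producer `twoPointKP_of_avgEvalExpLinear_box_decay` on the chart's constructed
support map (entropy `y·e^{a₁+d₁}·e^{Dθ} ≤ θ`, smallness `2ε·θ·(D+1) ≤ a₁`, `a₁ = d₁ = θ = 1`, `D = 2ν`), transported through
the dilation factor (`NE9BridgeWitnessData.twoPointKP_mul_of_norm_le_one`); the owner's COUPLING TWO-POINT clause `hCup`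
with `clip ≡ 1` (cross-uniform size because the majorant is coupling-free; two-point from the 1-Lipschitz factor `e^{−s}`);
the pin bound of the new term `≤ e^{−d(X)}`; the occupation `|q_k| ≤ 4` BY INDUCTION (`½·4 + 1 + 1`) and `hocc` (every
occurring table, hybrid ones included, in the box `‖T x‖ ≤ 8`); the CHANNEL COUPLING MODULUS `hTcup` with `qT ≡ 4`.
§5 `bridgeWitness_ne9`: for every window of histories with coordinates in `[0, 1]`, ALL binders of
`ne9_and_fadingMemory_of_couplingTwoPoint` hold for these data with `clip = 1`, `qT = 4`, `pex = 1`, `lip = 1/32`,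
`B = κ = 1`, `τ̄ = 2`, `ω = ½`, and the END returns `NE9 bE W 1 (prodModuli (11/2) (¾)) ∧ FadingMemory (22/3) (¾) (…)`:
modulus `ℓ = 4·clip·B + pex + 4·lip·B·qT = 11/2`, FADING rate `ω + 4·lip·B·τ̄ = ¾ < 1`; `bridgeWitness_moduli`: the
history bracket weighs `g_i` with `(11/2)(¾)^{k−i} > 0` — genuine, summable memory.
(v1.1) §6: the SIZE-INDUCTION face `NE9BridgeSizeInduction.ne9_and_fadingMemory_of_couplingTwoPoint_sizeInduction` inhabited
by the SAME data — the occupation is then DERIVED by the owner's port of road P2's size induction (binders (B0) base sizes,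
(X) explicit-part size `p₀ ≡ 1`, (N) budget `p₀ + B ≤ N ≡ 2`, (R′) box read-out via `sizeRadius ≤ 8`) instead of §4's own
induction, and the witness functional obeys the (I.1.18)-type size bound `TermSize bE W 1 (fun _ => 2)` as a by-product.

References (STRUCTURE only): [Balaban1987RG1] T. Bałaban, CMP **109** (1987), (2.10) p. 267, (2.12)–(2.13) p. 268;
[Balaban1988RG2Cluster] T. Bałaban, CMP **116** (1988), (2.14)–(2.15) p. 15, (2.30) p. 18, Lemma 3 (2.38) p. 20, (2.41) p. 21;
[KoteckyPreiss1986] R. Kotecký, D. Preiss, CMP **103** (1986), (1)–(3).  Nothing printed is used as a hypothesis.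
-/

noncomputable section

namespace Summit.QuantumFields.BalabanUV.T4Continuum.NE9BridgeWitness

open scoped BigOperators
open Metric Set MeasureTheory BoundedContinuousFunction
open Literature.Probability.LatticeModels
open Literature.MathematicalPhysics.QuantumFieldTheory.Balaban1983to89
open Literature.MathematicalPhysics.QuantumFieldTheory.Balaban1983to89.T4OutputRate
open Literature.MathematicalPhysics.QuantumFieldTheory.Balaban1983to89.T4ActivityLipschitz
open Literature.MathematicalPhysics.QuantumFieldTheory.Balaban1983to89.T4HistoryLipschitzRecursion
open Literature.MathematicalPhysics.QuantumFieldTheory.Balaban1983to89.T4HistoryLipschitzOuter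
open Literature.MathematicalPhysics.QuantumFieldTheory.Balaban1983to89.T4HistoryLipschitzActivity
open Literature.MathematicalPhysics.QuantumFieldTheory.Balaban1983to89.T4HistoryLipschitzSegment
open Literature.MathematicalPhysics.QuantumFieldTheory.Balaban1983to89.T4HistoryLipschitzCubeGeometry
open Literature.MathematicalPhysics.QuantumFieldTheory.Balaban1983to89.T4HistoryLipschitzWitness
open Literature.MathematicalPhysics.QuantumFieldTheory.Balaban1983to89.T4HistoryLipschitzActivity (ClusterGeom)
open Summit.QuantumFields.BalabanUV.T4Continuum.NE9LastCouplingBridge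
open Summit.QuantumFields.BalabanUV.T4Continuum.NE9BridgeWitnessData

/-! ## §4 The activity side: `TwoPointKP` DERIVED from decay, the coupling two-point clause, the occupation by induction -/

section ActivitySide

variable (ν N : ℕ)

/-- `0 ≤ ε′`. [folklore] -/
theorem bε_nonneg : 0 ≤ bε ν := by unfold bε; positivity

/-- **THE MAJORANT IN CLOSED FORM**: `bMaj k s U γ = 33·ε′·y^{#γ}` (Dirac average: `(1 + 32)·ε′y^{#γ}e^{−8}e^{8}`) — in
particular COUPLING-FREE. [folklore] -/
theorem bMaj_eq (k : ℕ) (s : ℝ) (U : Unit) (γ : Finset (Site ν N)) :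
    bMaj ν N k s U γ = 33 * bε ν * wy ν ^ γ.card := by
  have he : Real.exp (-8) * Real.exp 8 = 1 := by rw [← Real.exp_add]; norm_num
  have habs : |bε ν * wy ν ^ γ.card * Real.exp (-8)| = bε ν * wy ν ^ γ.card * Real.exp (-8) :=
    abs_of_nonneg (by have := bε_nonneg ν; have := wy_nonneg ν; positivity)
  simp only [bMaj, segMajorant, coeffSum, boxExponent, wμ, wc, bβ, bpre, integral_dirac, Finset.univ_unique,
    Finset.sum_singleton, norm_one, one_mul, Complex.norm_real, Real.norm_eq_abs, habs]
  linear_combination (33 * (bε ν * wy ν ^ γ.card)) * he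

/-- the smallness `2·(33ε′)·θ·(D + 1) ≤ a₁` with `θ = a₁ = 1`, `D = 2ν` (equality). [folklore] -/
theorem b_eps_theta (k : ℕ) : 2 * (fun _ : ℕ => 33 * bε ν) k * 1 * (((2 * ν : ℕ) : ℝ) + 1) ≤ 1 := by
  have h : (0 : ℝ) < 2 * (ν : ℝ) + 1 := by positivity
  simp only [bε]
  push_cast
  rw [show 2 * (33 * (1 / (66 * (2 * (ν : ℝ) + 1)))) * 1 * (2 * (ν : ℝ) + 1) = 1 by field_simp; ring]

/-- **`TwoPointKP` FOR THE BASE ACTIVITIES, DERIVED** (road P2's producer `twoPointKP_of_avgEvalExpLinear_box_decay` on the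
chart's constructed support map: decay `33ε′·y^{#γ}` of the segment majorant, entropy `y·e^{a₁+d₁}·e^{Dθ} ≤ θ` and
smallness — nothing assumed). [folklore] -/
theorem base_twoPointKP (W : Set (ℕ → ℝ)) :
    TwoPointKP (torusChart ν N).geom W (baseAct ν N) (fun k => boxSet (bβ k)) (bMaj ν N) (fun _ => (1 / 32 : ℝ))
      ((torusChart ν N).supported.sizeWeight 1) ((torusChart ν N).supported.sizeWeight 1) :=
  twoPointKP_of_avgEvalExpLinear_box_decay (torusChart ν N).supported (W := W) (ε := fun _ => 33 * bε ν) (y := wy ν)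
    (a₁ := 1) (d₁ := 1) (θ := 1) zero_le_one zero_le_one (fun _ => by norm_num)
    (fun k s U γ => by simp only [wμ]; exact aestronglyMeasurable_const) (w_c_meas ν N) (w_pt_meas ν N)
    (fun k s U γ => by simp only [wμ]; exact Integrable.of_finite)
    (fun k s U γ => by simp only [wμ]; exact Integrable.of_finite)
    (fun _ => by have := bε_nonneg ν; positivity) (wy_nonneg ν)
    (fun g _ k U X _ γ' _ => by
      rw [CubeChart.supported_supp]
      exact (bMaj_eq ν N k (g k) U γ').le)
    (w_theta ν) (b_eps_theta ν)

/-- **`TwoPointKP` FOR THE COUPLING-DEPENDENT ACTIVITIES** (`NE9BridgeWitnessData` §1: the factor `e^{−s}` has norm `≤ 1`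
at couplings `≥ 0`).
[folklore] -/
theorem bAct_twoPointKP {W : Set (ℕ → ℝ)} (hW : ∀ g ∈ W, ∀ i, 0 ≤ g i ∧ g i ≤ 1) :
    TwoPointKP (torusChart ν N).geom W (bAct ν N) (fun k => boxSet (bβ k)) (bMaj ν N) (fun _ => (1 / 32 : ℝ))
      ((torusChart ν N).supported.sizeWeight 1) ((torusChart ν N).supported.sizeWeight 1) :=
  twoPointKP_mul_of_norm_le_one (torusChart ν N).geom (base_twoPointKP ν N W)
    (fun (_ : ℕ) (s : ℝ) => ((Real.exp (-s) : ℝ) : ℂ)) fun g hg k => by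
      rw [Complex.norm_real, Real.norm_eq_abs, abs_of_pos (Real.exp_pos _), Real.exp_le_one_iff]
      linarith [(hW g hg k).1]

/-- **THE COUPLING TWO-POINT CLAUSE `hCup` WITH `clip ≡ 1`** (the owner's binder shape): cross-uniform size (the majorant is
coupling-free) and the two-point bound from the 1-Lipschitz dilation factor. [folklore] -/
theorem b_hCup {W : Set (ℕ → ℝ)} (hW : ∀ g ∈ W, ∀ i, 0 ≤ g i ∧ g i ≤ 1) :
    ∀ g ∈ W, ∀ g' ∈ W, ∀ (k : ℕ) (U : Unit) (X : (torusCarriers ν N).Dom), (torusCarriers ν N).scale X = k + 1 →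
      ∀ Q ∈ (fun k => boxSet (bβ k)) k, ∀ γ ∈ (torusChart ν N).geom.vol X,
        ‖bAct ν N k (g k) U Q γ‖ ≤ bMaj ν N k (g' k) U γ ∧
          ‖bAct ν N k (g k) U Q γ - bAct ν N k (g' k) U Q γ‖ ≤
            (fun _ : ℕ => (1 : ℝ)) k * |g k - g' k| * bMaj ν N k (g' k) U γ := by
  intro g hg g' hg' k U X hX Q hQ γ hγ
  obtain ⟨-, -, -, hP⟩ := base_twoPointKP ν N W
  obtain ⟨hbd, -, -⟩ := hP g hg k U X hX
  have hsize : ‖baseAct ν N k (g k) U Q γ‖ ≤ bMaj ν N k (g' k) U γ := by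
    rw [bMaj_eq]
    have h := hbd Q hQ γ hγ
    rw [bMaj_eq] at h
    exact h
  have hbase : baseAct ν N k (g k) U Q γ = baseAct ν N k (g' k) U Q γ := rfl
  have hc1 : ‖((Real.exp (-(g k)) : ℝ) : ℂ)‖ ≤ 1 := by
    rw [Complex.norm_real, Real.norm_eq_abs, abs_of_pos (Real.exp_pos _), Real.exp_le_one_iff]
    linarith [(hW g hg k).1]
  refine ⟨?_, ?_⟩
  · calc ‖bAct ν N k (g k) U Q γ‖ = ‖((Real.exp (-(g k)) : ℝ) : ℂ)‖ * ‖baseAct ν N k (g k) U Q γ‖ := norm_mul _ _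
      _ ≤ 1 * bMaj ν N k (g' k) U γ := mul_le_mul hc1 hsize (norm_nonneg _) zero_le_one
      _ = bMaj ν N k (g' k) U γ := one_mul _
  · have e : bAct ν N k (g k) U Q γ - bAct ν N k (g' k) U Q γ =
        (((Real.exp (-(g k)) : ℝ) : ℂ) - ((Real.exp (-(g' k)) : ℝ) : ℂ)) * baseAct ν N k (g k) U Q γ := by
      simp only [bAct]
      rw [hbase, sub_mul]
    rw [e, norm_mul, ← Complex.ofReal_sub, Complex.norm_real, Real.norm_eq_abs]
    calc |Real.exp (-(g k)) - Real.exp (-(g' k))| * ‖baseAct ν N k (g k) U Q γ‖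
        ≤ |g k - g' k| * bMaj ν N k (g' k) U γ :=
          mul_le_mul (Literature.NumberTheory.LFunctions.abs_exp_neg_sub_exp_neg_le (hW g hg k).1 (hW g' hg' k).1) hsize
            (norm_nonneg _) (abs_nonneg _)
      _ = (fun _ : ℕ => (1 : ℝ)) k * |g k - g' k| * bMaj ν N k (g' k) U γ := by simp

/-- a read-out table of a channel value of size `≤ 8` lies in the admissible box. [folklore] -/
theorem wρ_mem_box {k : ℕ} {P : Unit → ℝ} (hP : |P ()| ≤ 8) : wρ k P ∈ boxSet (bβ k) := by
  refine closedBall_subset_boxSet (8 : ℝ) ?_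
  rw [mem_closedBall_zero_iff, norm_wρ]
  exact hP

/-- **THE PIN BOUND OF THE WITNESS NEW TERM** at an admissible table: `‖new term‖ ≤ e^{−d(X)}` (road P2's
`norm_newTerm_le_of_twoPointKP` with the chart's `DecayExtract`/`PinBudget`, `a₁ = d₁ = κ = B = 1`). [folklore] -/
theorem norm_newTerm_le {W : Set (ℕ → ℝ)} (hW : ∀ g ∈ W, ∀ i, 0 ≤ g i ∧ g i ≤ 1) {g : ℕ → ℝ} (hg : g ∈ W) {k : ℕ}
    (U : Unit) {X : (torusCarriers ν N).Dom} (hX : (torusCarriers ν N).scale X = k + 1) {Q : ℝ →ᵇ ℂ}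
    (hQ : Q ∈ boxSet (bβ k)) :
    ‖(torusChart ν N).geom.newTerm (bAct ν N) k (g k) U X Q‖ ≤ Real.exp (-(1 * (torusCarriers ν N).d X)) := by
  have h := norm_newTerm_le_of_twoPointKP (torusChart ν N).geom (bAct_twoPointKP ν N hW)
    ((torusChart ν N).decayExtract zero_le_one) ((torusChart ν N).pinBudget zero_le_one zero_le_one le_rfl) hg
    (U := U) hX hQ
  simpa using h

/-- the size of a clamped channel value: `|(1 + clampU s)·q| ≤ 8` when `|q| ≤ 4`. [folklore] -/
theorem abs_clampUMul_le {s q : ℝ} (hq : |q| ≤ 4) : |(1 + clampU s) * q| ≤ 8 := by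
  have hc0 := clampU_nonneg s
  have hc1 := clampU_le_one s
  rw [abs_mul, abs_of_nonneg (by linarith)]
  nlinarith [abs_nonneg q]

/-- **THE OCCUPATION BOUND BY INDUCTION**: on a window of histories with coordinates in `[0, 1]`, `|q_k(g)| ≤ 4` —
`|q_{k+1}| ≤ ½·4 + |new term| + |g_k| ≤ 2 + 1 + 1`, the new term evaluated at the table `(1 + g_k)q_k` of norm `≤ 8`.
[folklore] -/
theorem abs_bOut_le {W : Set (ℕ → ℝ)} (hW : ∀ g ∈ W, ∀ i, 0 ≤ g i ∧ g i ≤ 1) {g : ℕ → ℝ} (hg : g ∈ W) :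
    ∀ k, |bOut ν N g k| ≤ 4
  | 0 => by norm_num [bOut]
  | k + 1 => by
      have ih := abs_bOut_le hW hg k
      have hN := norm_newTerm_le ν N hW hg () (scale_refDom ν N (k + 1))
        (wρ_mem_box (k := k) (P := fun _ => (1 + clampU (g k)) * bOut ν N g k) (abs_clampUMul_le ih))
      rw [d_refDom, mul_zero, neg_zero, Real.exp_zero] at hN
      have hgk := hW g hg k
      rw [bOut_succ]
      calc |(1 / 2 : ℝ) * bOut ν N g k +
            bΨ ν N k (g k) (fun _ => (1 + clampU (g k)) * bOut ν N g k) () (refDom ν N (k + 1))|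
          ≤ |(1 / 2 : ℝ) * bOut ν N g k| +
            |bΨ ν N k (g k) (fun _ => (1 + clampU (g k)) * bOut ν N g k) () (refDom ν N (k + 1))| := abs_add_le _ _
        _ ≤ 2 + (1 + 1) := by
            refine add_le_add ?_ ?_
            · rw [abs_mul, abs_of_pos (by norm_num : (0 : ℝ) < 1 / 2)]
              linarith
            · refine (abs_add_le _ _).trans (add_le_add ((Complex.abs_re_le_norm _).trans hN) ?_)
              simp only [expl, d_refDom, mul_zero, neg_zero, Real.exp_zero, one_mul]
              rw [abs_of_nonneg hgk.1]
              exact hgk.2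
        _ = 4 := by norm_num

/-- **THE OCCUPATION `hocc`**: every occurring read-out table — the hybrid ones `ρ(T_k(g′)(E g))` included — lies in the
admissible box (`|(1 + g′_k)·q_k(g)| ≤ 2·4 = 8`). [folklore] -/
theorem b_occ {W : Set (ℕ → ℝ)} (hW : ∀ g ∈ W, ∀ i, 0 ≤ g i ∧ g i ≤ 1) :
    ∀ g ∈ W, ∀ g' ∈ W, ∀ k : ℕ, wρ k (bT ν N k g' (bE ν N g)) ∈ (fun k => boxSet (bβ k)) k := by
  intro g hg g' _ k
  rw [bT_bE ν N g g' k]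
  exact wρ_mem_box (abs_clampUMul_le (abs_bOut_le ν N hW hg k))

/-- **THE CHANNEL COUPLING MODULUS `hTcup` WITH `qT ≡ 4`** (weights `wt ≡ 1`): the channel read at two coupling ARGUMENTS on
the SAME terms differs by the clampU's increment times the own-history output `|q_k(g)| ≤ 4`. [folklore] -/
theorem b_Tcup {W : Set (ℕ → ℝ)} (hW : ∀ g ∈ W, ∀ i, 0 ≤ g i ∧ g i ≤ 1) :
    ∀ g ∈ W, ∀ g' ∈ W, ∀ (k : ℕ) (y : Unit),
      |bT ν N k g (bE ν N g) y - bT ν N k g' (bE ν N g) y| ≤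
        (fun (_ : ℕ) (_ : Unit) => (1 : ℝ)) k y * ((fun _ : ℕ => (4 : ℝ)) k * |g k - g' k|) := by
  intro g hg g' _ k y
  rw [bT_bE ν N g g k, bT_bE ν N g g' k]
  have ih := abs_bOut_le ν N hW hg k
  show |(1 + clampU (g k)) * bOut ν N g k - (1 + clampU (g' k)) * bOut ν N g k| ≤ 1 * (4 * |g k - g' k|)
  rw [← sub_mul, abs_mul, add_sub_add_left_eq_sub]
  calc |clampU (g k) - clampU (g' k)| * |bOut ν N g k| ≤ |g k - g' k| * 4 :=
      mul_le_mul (abs_clampU_sub_clampU_le _ _) ih (abs_nonneg _) (abs_nonneg _)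
    _ = 1 * (4 * |g k - g' k|) := by ring

/-- the geometric envelope of the creation-step coefficients: `0 ≤ 2(½)^{k−j} ≤ 2·(½)^{k−j}`. [folklore] -/
theorem b_tau : ∀ k j : ℕ, j ≤ k →
    0 ≤ (fun k j : ℕ => 2 * (1 / 2 : ℝ) ^ (k - j)) k j ∧
      (fun k j : ℕ => 2 * (1 / 2 : ℝ) ^ (k - j)) k j ≤ 2 * (1 / 2 : ℝ) ^ (k - j) :=
  fun k j _ => ⟨by positivity, le_rfl⟩

end ActivitySide

/-! ## §5 THE BRIDGE WITNESS: every binder of `ne9_and_fadingMemory_of_couplingTwoPoint` discharged -/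

section Headline

variable (ν N : ℕ)

/-- **JOINT NON-VACUITY OF THE BRIDGE END WITH `clip, qT, pex > 0` AND GENUINE FADING MEMORY.**  On the torus cube chart
`torusChart ν N`, for every window of histories with coordinates in `[0, 1]`, the data of `NE9BridgeWitnessData` §2 (activities
with the dilation
factor `e^{−s}`, coupling-reading channel with geometric memory `ω = ½`, explicit part `e^{−d(X)}·s`, functional defined by
the recursion) satisfy EVERY binder of the row owner's END `NE9LastCouplingBridge.ne9_and_fadingMemory_of_couplingTwoPoint`
with `clip = 1`, `qT = 4`, `pex = 1`, `lip = lipbar = 1/32`, `B = κ = 1`, `τ̄ = 2`, `ω = ½`, `TwoPointKP` DERIVED from decay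
and the occupation DERIVED by induction; the END returns NE9 with the product moduli of rate `½ + 4·(1/32)·1·2 = ¾ < 1` and
`ℓ = 4·1·1 + 1 + 4·(1/32)·1·4 = 11/2`, i.e. `FadingMemory (22/3) (3/4)`.  A toy inhabitant of displayed hypotheses: closes
no estimate of the manuscripts; NE9 NOT proved. [folklore] -/
theorem bridgeWitness_ne9 {W : Set (ℕ → ℝ)} (hW : ∀ g ∈ W, ∀ i, 0 ≤ g i ∧ g i ≤ 1) :
    NE9 (C := torusCarriers ν N) (bE ν N) W 1 (prodModuli (11 / 2) fun _ => (3 : ℝ) / 4) ∧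
      FadingMemory ((22 : ℝ) / 3) (3 / 4) (prodModuli (11 / 2) fun _ => (3 : ℝ) / 4) := by
  have h := ne9_and_fadingMemory_of_couplingTwoPoint (torusChart ν N).geom (E := bE ν N) (W := W) (Adm := Set.univ)
    (T := bT ν N) (Ψ := bΨ ν N) (act := bAct ν N) (𝒜 := fun k => boxSet (bβ k)) (n := bMaj ν N)
    (lip := fun _ => (1 / 32 : ℝ)) (clip := fun _ => (1 : ℝ)) (a := (torusChart ν N).supported.sizeWeight 1)
    (d := (torusChart ν N).supported.sizeWeight 1) (δ := fun X => 1 * (((torusChart ν N).cubes X).card : ℝ))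
    (κ := 1) (B := 1) (lipbar := 1 / 32) (clipbar := 1) (pexbar := 1) (qTbar := 4) (τbar := 2) (ω := 1 / 2)
    (wt := fun _ _ => (1 : ℝ)) (τ := fun k j => 2 * (1 / 2 : ℝ) ^ (k - j)) (pex := fun _ => (1 : ℝ))
    (qT := fun _ => (4 : ℝ)) wρ (expl ν N) (b_scaleZeroFree ν N W) (b_admissible ν N W) (w_admRestrict ν N)
    (b_channelAdditive ν N) (b_channelStepSum ν N) (b_channelSizeAtStepNN ν N) (b_factorises ν N W)
    (fun _ => zero_le_one) (b_hCup ν N hW) (fun _ => by norm_num) (b_Tcup ν N hW) (b_repr ν N) (b_expl ν N W)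
    (fun _ => le_rfl) (fun _ => le_rfl) zero_le_one (fun _ => le_rfl) (bAct_twoPointKP ν N hW)
    ((torusChart ν N).decayExtract zero_le_one) ((torusChart ν N).pinBudget zero_le_one zero_le_one le_rfl) w_read
    (b_occ ν N hW) zero_le_one (fun _ => le_rfl) (by norm_num) (by norm_num) (by norm_num) b_tau
  have e1 : (1 : ℝ) / 2 + 4 * (1 / 32) * 1 * 2 = 3 / 4 := by norm_num
  have e2 : (4 : ℝ) * 1 * 1 + 1 + 4 * (1 / 32) * 1 * 4 = 11 / 2 := by norm_num
  have e3 : ((11 : ℝ) / 2) / (3 / 4) = 22 / 3 := by norm_num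
  simp only [e1, e2, e3] at h
  exact h

/-- The memory of the bridge witness in numbers: at creation step `k + 1` the history bracket weighs `g_i`, `i ≤ k`, with
`(11/2)·(¾)^{k−i}` — positive for every earlier step, and summable. [folklore] -/
theorem bridgeWitness_moduli (k i : ℕ) (hik : i ≤ k) :
    prodModuli (11 / 2) (fun _ => (3 : ℝ) / 4) (k + 1) i = 11 / 2 * (3 / 4 : ℝ) ^ (k - i) := by
  rw [prodModuli_const, if_pos (Nat.lt_succ_of_le hik), Nat.add_sub_cancel]

end Headline

/-! ## §6 (v1.1) THE SIZE-INDUCTION FACE inhabited by the same data: `TermSize` as a by-product, the occupation DERIVED by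
`NE9BridgeSizeInduction` (the owner's port of road P2's size induction) instead of §4's own induction -/

section SizeFace

variable (ν N : ℕ)

/-- binder (X): the explicit part's one-run size `|e^{−d X}·g_k| ≤ e^{−d X}·1` on a window with coordinates in `[0, 1]`
(`p₀ ≡ 1`). [folklore] -/
theorem b_explSize {W : Set (ℕ → ℝ)} (hW : ∀ g ∈ W, ∀ i, 0 ≤ g i ∧ g i ≤ 1) :
    ∀ g ∈ W, ∀ (k : ℕ) (U : Unit) (X : (torusCarriers ν N).Dom), (torusCarriers ν N).scale X = k + 1 →
      |expl ν N k (g k) U X| ≤ Real.exp (-(1 * (torusCarriers ν N).d X)) * (fun _ : ℕ => (1 : ℝ)) k := by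
  intro g hg k U X _
  simp only [expl]
  rw [abs_mul, abs_of_pos (Real.exp_pos _), abs_of_nonneg (hW g hg k).1]
  exact mul_le_mul_of_nonneg_left (hW g hg k).2 (Real.exp_pos _).le

/-- binder (B0): nothing is created on creation step `0`, so the base sizes hold with any nonnegative profile value. [folklore] -/
theorem b_base (W : Set (ℕ → ℝ)) : ∀ g ∈ W, ∀ (U : Unit) (X : (torusCarriers ν N).Dom), (torusCarriers ν N).scale X = 0 →
    |bE ν N g U X| ≤ Real.exp (-(1 * (torusCarriers ν N).d X)) * (fun _ : ℕ => (2 : ℝ)) 0 := by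
  intro g _ U X hX
  rw [bE_zero ν N g U X hX, abs_zero]
  positivity

/-- binder (R′): the weighted box of radius `sizeRadius τ N k = Σ_{j≤k} 2(½)^{k−j}·2 ≤ 8` is read INTO the admissible box
`‖T x‖ ≤ 8` (`sizeRadius_le_of_geometric`: `2/(1 − ½)·2 = 8`). [folklore] -/
theorem b_box : ∀ (k : ℕ) (P : Unit → ℝ),
    (∀ y, |P y| ≤ (fun (_ : ℕ) (_ : Unit) => (1 : ℝ)) k y *
      sizeRadius (fun k j => 2 * (1 / 2 : ℝ) ^ (k - j)) (fun _ => (2 : ℝ)) k) →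
      wρ k P ∈ (fun k => boxSet (bβ k)) k := by
  intro k P hP
  have hR := sizeRadius_le_of_geometric (τ := fun k j => 2 * (1 / 2 : ℝ) ^ (k - j)) (N := fun _ => (2 : ℝ))
    (τbar := 2) (ω := 1 / 2) (Nbar := 2) (by norm_num) (by norm_num) (by norm_num) b_tau (fun _ => ⟨by norm_num, le_rfl⟩) k
  refine wρ_mem_box ?_
  have h := hP ()
  have h8 : (2 : ℝ) / (1 - 1 / 2) * 2 = 8 := by norm_num
  rw [h8] at hR
  linarith

/-- **THE SIZE-INDUCTION FACE INHABITED (same data; occupation DERIVED, term sizes as a by-product).**  For every window of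
histories with coordinates in `[0, 1]`, the owner's `NE9BridgeSizeInduction.ne9_and_fadingMemory_of_couplingTwoPoint_sizeInduction`
applies to the data of `NE9BridgeWitnessData` with `p₀ ≡ 1`, `N ≡ 2` (budget `1 + 1 ≤ 2`), box radius `8`, all other letters as
in §5: `TermSize bE W 1 (fun _ => 2)` (every witness term is `≤ 2e^{−d(X)}` — the (I.1.18) TYPE) ∧ NE9 ∧ FadingMemory with
the §5 moduli.  Toy inhabitant; NE9 NOT proved. [folklore] -/
theorem bridgeWitness_termSize_ne9 {W : Set (ℕ → ℝ)} (hW : ∀ g ∈ W, ∀ i, 0 ≤ g i ∧ g i ≤ 1) :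
    TermSize (C := torusCarriers ν N) (bE ν N) W 1 (fun _ => (2 : ℝ)) ∧
      NE9 (C := torusCarriers ν N) (bE ν N) W 1 (prodModuli (11 / 2) fun _ => (3 : ℝ) / 4) ∧
        FadingMemory ((22 : ℝ) / 3) (3 / 4) (prodModuli (11 / 2) fun _ => (3 : ℝ) / 4) := by
  have h := NE9BridgeSizeInduction.ne9_and_fadingMemory_of_couplingTwoPoint_sizeInduction (torusChart ν N).geom
    (E := bE ν N) (W := W) (Adm := Set.univ) (T := bT ν N) (Ψ := bΨ ν N) (act := bAct ν N) (𝒜 := fun k => boxSet (bβ k))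
    (n := bMaj ν N) (lip := fun _ => (1 / 32 : ℝ)) (clip := fun _ => (1 : ℝ)) (a := (torusChart ν N).supported.sizeWeight 1)
    (d := (torusChart ν N).supported.sizeWeight 1) (δ := fun X => 1 * (((torusChart ν N).cubes X).card : ℝ))
    (κ := 1) (B := 1) (lipbar := 1 / 32) (clipbar := 1) (pexbar := 1) (qTbar := 4) (τbar := 2) (ω := 1 / 2)
    (wt := fun _ _ => (1 : ℝ)) (τ := fun k j => 2 * (1 / 2 : ℝ) ^ (k - j)) (pex := fun _ => (1 : ℝ))
    (qT := fun _ => (4 : ℝ)) (p₀ := fun _ => (1 : ℝ)) (N := fun _ => (2 : ℝ)) wρ (expl ν N) (b_scaleZeroFree ν N W)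
    (b_admissible ν N W) (w_admRestrict ν N) (b_channelAdditive ν N) (b_channelStepSum ν N) (b_channelSizeAtStepNN ν N)
    (b_factorises ν N W) (fun _ => zero_le_one) (b_hCup ν N hW) (fun _ => by norm_num) (b_Tcup ν N hW) (b_repr ν N)
    (b_expl ν N W) (fun _ => le_rfl) (fun _ => le_rfl) zero_le_one (fun _ => le_rfl) (bAct_twoPointKP ν N hW)
    ((torusChart ν N).decayExtract zero_le_one) ((torusChart ν N).pinBudget zero_le_one zero_le_one le_rfl) w_read
    (b_explSize ν N hW) (b_base ν N W) (fun _ => by norm_num) (fun _ => by norm_num) b_box zero_le_one (fun _ => le_rfl)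
    (by norm_num) (by norm_num) (by norm_num) b_tau
  have e1 : (1 : ℝ) / 2 + 4 * (1 / 32) * 1 * 2 = 3 / 4 := by norm_num
  have e2 : (4 : ℝ) * 1 * 1 + 1 + 4 * (1 / 32) * 1 * 4 = 11 / 2 := by norm_num
  have e3 : ((11 : ℝ) / 2) / (3 / 4) = 22 / 3 := by norm_num
  simp only [e1, e2, e3] at h
  exact h

end SizeFace

end Summit.QuantumFields.BalabanUV.T4Continuum.NE9BridgeWitness

end
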